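import Mathlib
import HarnessLib

/-!
# Lebesgue measure near the origin, pushed forward by a linear surjection, dominates a multiple of Lebesgue measure near the origin

HONEST FRAMING: exact (Metropolis-corrected) sampling algorithms for lattice gauge theory;
figures of merit are autocorrelation/cost numbers at stated couplings and volumes; no
continuum-physics claim.

Venture `LatticeQCDFlow` (cell pub-lqcd), topic `Exactness`, FANOUT row 9 (eng-latcore, the
engine `latflow.core`: `updates.sweep_metropolis` draws the diagonal of its `𝔰𝔲(N)` kick as `N`
box-uniform numbers MINUS THEIR MEAN — the law of the kick is the image of a box-uniform law under
a linear SURJECTION onto the algebra, not a product law in injective coordinates).  NEW WORK of the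
cell over Mathlib (additive Haar measures on finite-dimensional real normed spaces: images under
continuous linear equivalences `ContinuousLinearEquiv.isAddHaarMeasure_map`, products
`Measure.prod.instIsAddHaarMeasure`, uniqueness `isAddLeftInvariant_eq_smul`; linear algebra:
`LinearMap.exists_rightInverse_of_surjective`); nothing here is cited as a fact.

* `kerSplit T σ hσ : V ≃ₗ[ℝ] F × ker T` — the splitting `v ↦ (T v, v − σ (T v))` given a linear
  section `σ` of the surjection `T` (inverse `(y, k) ↦ σ y + k`); `fst_kerSplit` (`T = fst ∘ split`).
* **`exists_smul_restrict_le_map_of_surjective`** — for additive Haar measures `μ_V`, `μ_F` on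
  finite-dimensional `V`, `F`, a linear surjection `T : V → F` and any neighbourhood `O` of `0` in
  `V`: there are a neighbourhood `W` of `0` in `F` and `c ≠ 0` with `c • μ_F|_W ≤ (μ_V|_O) ∘ T⁻¹`.
  (Through the splitting, `μ_V` is a constant multiple of `μ_F ⊗ Haar_{ker T}`, and `O` contains a
  product neighbourhood `W × W'`; `c = const · Haar_{ker T}(W')`.)

NOT CLAIMED: the value of the constant; anything for non-surjective maps.
-/

noncomputable section

namespace Summit.Ventures.LatticeQCDFlow.Exactness

open MeasureTheory Measure Set Filter Topology Function
open scoped ENNReal NNReal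

variable {V F : Type*} [AddCommGroup V] [Module ℝ V] [AddCommGroup F] [Module ℝ F]

/-- **The splitting of `V` along a linear surjection**: `v ↦ (T v, v − σ (T v)) ∈ F × ker T` for a
linear section `σ` (`T ∘ σ = id`), with inverse `(y, k) ↦ σ y + k`. -/
def kerSplit (T : V →ₗ[ℝ] F) (σ : F →ₗ[ℝ] V) (hσ : T ∘ₗ σ = LinearMap.id) : V ≃ₗ[ℝ] F × LinearMap.ker T where
  toFun v := (T v, ⟨v - σ (T v), by
    have h := LinearMap.congr_fun hσ (T v)
    simp only [LinearMap.coe_comp, Function.comp_apply, LinearMap.id_coe, id_eq] at h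
    rw [LinearMap.mem_ker, map_sub, h, sub_self]⟩)
  invFun p := σ p.1 + (p.2 : V)
  map_add' v w := by
    ext
    · simp [map_add]
    · simp only [map_add, Prod.mk_add_mk, Submodule.coe_add]
      abel
  map_smul' c v := by
    ext
    · simp [map_smul]
    · simp only [map_smul, RingHom.id_apply, Prod.smul_mk, SetLike.val_smul, smul_sub]
  left_inv v := by
    change σ (T v) + (v - σ (T v)) = v
    abel
  right_inv p := by
    obtain ⟨y, k, hk⟩ := p
    have h := LinearMap.congr_fun hσ y
    simp only [LinearMap.coe_comp, Function.comp_apply, LinearMap.id_coe, id_eq] at h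
    have hk0 : T k = 0 := (LinearMap.mem_ker.1 hk)
    ext
    · change T (σ y + k) = y
      rw [map_add, h, hk0, add_zero]
    · change σ y + k - σ (T (σ y + k)) = k
      rw [map_add, h, hk0, add_zero, add_sub_cancel_left]

/-- The first component of the splitting is `T`. -/
@[simp] theorem fst_kerSplit (T : V →ₗ[ℝ] F) (σ : F →ₗ[ℝ] V) (hσ : T ∘ₗ σ = LinearMap.id) (v : V) :
    (kerSplit T σ hσ v).1 = T v := rfl

/-- A linear surjection onto a vector space has a linear section. -/
theorem exists_section (T : V →ₗ[ℝ] F) (hT : Surjective T) : ∃ σ : F →ₗ[ℝ] V, T ∘ₗ σ = LinearMap.id :=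
  T.exists_rightInverse_of_surjective (LinearMap.range_eq_top.2 hT)

section Measure

variable {V F : Type*} [NormedAddCommGroup V] [NormedSpace ℝ V] [FiniteDimensional ℝ V] [MeasurableSpace V] [BorelSpace V]
  [NormedAddCommGroup F] [NormedSpace ℝ F] [FiniteDimensional ℝ F] [MeasurableSpace F] [BorelSpace F]

/-- **LEBESGUE MEASURE NEAR `0`, PUSHED FORWARD BY A LINEAR SURJECTION, DOMINATES A MULTIPLE OF
LEBESGUE MEASURE NEAR `0`.**  For additive Haar measures `μ_V`, `μ_F`, a linear surjection `T : V → F`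
and a neighbourhood `O` of `0` in `V`: there are a neighbourhood `W` of `0` in `F` and `c ≠ 0` with
`c • μ_F|_W ≤ (μ_V|_O) ∘ T⁻¹`. -/
theorem exists_smul_restrict_le_map_of_surjective (T : V →ₗ[ℝ] F) (hT : Surjective T)
    (μV : Measure V) [IsAddHaarMeasure μV] (μF : Measure F) [IsAddHaarMeasure μF] {O : Set V} (hO : O ∈ 𝓝 (0 : V)) :
    ∃ W ∈ 𝓝 (0 : F), ∃ c : ℝ≥0∞, c ≠ 0 ∧ c • μF.restrict W ≤ (μV.restrict O).map T := by
  obtain ⟨σ, hσ⟩ := exists_section T hT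
  -- the splitting as a continuous linear equivalence, and the transported Haar measure
  set Ψ : V ≃L[ℝ] F × LinearMap.ker T := (kerSplit T σ hσ).toContinuousLinearEquiv with hΨ
  have hΨT : ∀ v, (Ψ v).1 = T v := fun v => rfl
  set μ' : Measure (F × LinearMap.ker T) := μV.map Ψ with hμ'
  haveI : IsAddHaarMeasure μ' := Ψ.isAddHaarMeasure_map μV
  set μK : Measure (LinearMap.ker T) := Measure.addHaar with hμK
  -- uniqueness of Haar measure on `F × ker T`
  obtain ⟨c₀, hc₀, hμ'eq⟩ : ∃ c₀ : ℝ≥0, 0 < c₀ ∧ μ' = c₀ • μF.prod μK :=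
    ⟨addHaarScalarFactor μ' (μF.prod μK), addHaarScalarFactor_pos_of_isAddHaarMeasure _ _,
      isAddLeftInvariant_eq_smul μ' (μF.prod μK)⟩
  -- a product neighbourhood inside `Ψ O`
  have hΨO : Ψ '' O ∈ 𝓝 (0 : F × LinearMap.ker T) := by
    have h := Ψ.toHomeomorph.isOpenMap.image_mem_nhds hO
    rwa [show Ψ.toHomeomorph 0 = 0 from map_zero Ψ] at h
  obtain ⟨W₁, hW₁, W₂, hW₂, hprod⟩ := mem_nhds_prod_iff.1 hΨO
  obtain ⟨W, hWW₁, hWopen, h0W⟩ := mem_nhds_iff.1 hW₁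
  obtain ⟨W', hW'W₂, hW'open, h0W'⟩ := mem_nhds_iff.1 hW₂
  have hW'pos : μK W' ≠ 0 := (hW'open.measure_pos μK ⟨0, h0W'⟩).ne'
  have hTm : Measurable T := T.continuous_of_finiteDimensional.measurable
  have hΨm : Measurable Ψ := Ψ.continuous.measurable
  refine ⟨W, hWopen.mem_nhds h0W, c₀ * μK W', mul_ne_zero (ENNReal.coe_ne_zero.2 hc₀.ne') hW'pos,
    Measure.le_iff.2 fun B hB => ?_⟩
  rw [Measure.smul_apply, smul_eq_mul, Measure.restrict_apply hB, Measure.map_apply hTm hB,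
    Measure.restrict_apply (hB.preimage hTm)]
  -- `Ψ⁻¹ ((B ∩ W) × W') ⊆ T⁻¹ B ∩ O`
  have hsub : Ψ ⁻¹' ((B ∩ W) ×ˢ W') ⊆ T ⁻¹' B ∩ O := by
    intro v hv
    obtain ⟨⟨hvB, hvW⟩, hvW'⟩ := mem_prod.1 hv
    refine ⟨by simpa [hΨT] using hvB, ?_⟩
    have hmem : Ψ v ∈ Ψ '' O := hprod (mk_mem_prod (hWW₁ hvW) (hW'W₂ hvW'))
    obtain ⟨w, hwO, hw⟩ := hmem
    rwa [← Ψ.injective hw]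
  calc (c₀ : ℝ≥0∞) * μK W' * μF (B ∩ W) = (c₀ • μF.prod μK) ((B ∩ W) ×ˢ W') := by
        rw [Measure.smul_apply, Measure.prod_prod, ENNReal.smul_def, smul_eq_mul]; ring
    _ = μ' ((B ∩ W) ×ˢ W') := by rw [hμ'eq]
    _ = μV (Ψ ⁻¹' ((B ∩ W) ×ˢ W')) := by
        rw [hμ', Measure.map_apply hΨm ((hB.inter hWopen.measurableSet).prod hW'open.measurableSet)]
    _ ≤ μV (T ⁻¹' B ∩ O) := measure_mono hsub

end Measure

end Summit.Ventures.LatticeQCDFlow.Exactness
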